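import Mathlib
import Literature.Computability.AlgebraicComplexity.BirkhoffShadow

/-!
# Crux `MatrixDescartes` (stmt-ValiantsHypothesis-18050), line `Lift` — registered stub `stub_shadowTransport`

TRANSPORT of a plane shadow of the permutation matrices along a relabelling of the nodes.
A sibling stub of the line builds a linear projection `L : ℝ^{α × α} → ℝ²` of the permutation
matrices over a structured node type `α`; this file moves it to the tree's
`permMatrixPoints n ⊆ ℝ^{Fin n × Fin n}`
(`Literature.Computability.AlgebraicComplexity.permMatrixPoints`) along any enumeration
`e : α ≃ Fin n`, keeping the IMAGE SET literally equal (hence also its convex hull and the number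
of hull vertices).

Construction. Let `R : ℝ^{Fin n × Fin n} → ℝ^{α × α}` be precomposition with
`(a, b) ↦ (e a, e b)` (`LinearMap.funLeft`), and put `L' := L ∘ R`. For a permutation `ρ` of
`Fin n`, `R` sends the matrix of `ρ` (entry `(i, j) = 1` iff `ρ j = i`) to the matrix of the
conjugate permutation `e⁻¹ ∘ ρ ∘ e` of `α`, since `ρ (e b) = e a ↔ e⁻¹ (ρ (e b)) = a`; conversely
the matrix of `ρ' : Perm α` is the `R`-image of the matrix of `e ∘ ρ' ∘ e⁻¹`. Hence
`R '' permMatrixPoints n` is exactly the set of permutation matrices over `α`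
(`StubShadowTransport.image_funLeft_permMatrixPoints`), and `L' '' permMatrixPoints n =
L '' (R '' permMatrixPoints n)` is the required image (`Set.image_comp`).

Elementary; Mathlib + the tree definition `permMatrixPoints`
(axioms `propext`, `Classical.choice`, `Quot.sound`).
-/

-- layout Summits/ValiantsHypothesis/ValiantsHypothesis forces the duplicated namespace component
set_option linter.dupNamespace false

namespace Summit.ValiantsHypothesis.ValiantsHypothesis.Theorems.LacunarySymmetroidMatrixDescartes

open Literature.Computability.AlgebraicComplexity

namespace StubShadowTransport

/-- The relabelling `R = LinearMap.funLeft ℝ ℝ ((a, b) ↦ (e a, e b))` maps the permutation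
matrices over `Fin n` onto the permutation matrices over `α`: the matrix of `ρ : Perm (Fin n)`
goes to the matrix of the conjugate `e⁻¹ ∘ ρ ∘ e`, and every `ρ' : Perm α` arises from
`ρ = e ∘ ρ' ∘ e⁻¹`. -/
theorem image_funLeft_permMatrixPoints (α : Type) [DecidableEq α] (n : ℕ) (e : α ≃ Fin n) :
    LinearMap.funLeft ℝ ℝ (fun ab : α × α => (e ab.1, e ab.2)) '' permMatrixPoints n =
      {x : α × α → ℝ | ∃ ρ : Equiv.Perm α, x = fun ij => if ρ ij.2 = ij.1 then 1 else 0} := by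
  ext x
  simp only [Set.mem_image, permMatrixPoints, Set.mem_setOf_eq]
  constructor
  · rintro ⟨y, ⟨ρ, rfl⟩, rfl⟩
    refine ⟨(e.trans ρ).trans e.symm, ?_⟩
    funext ij
    simp only [LinearMap.funLeft_apply, Equiv.trans_apply, Equiv.symm_apply_eq]
  · rintro ⟨ρ, rfl⟩
    refine ⟨fun ij => if ((e.symm.trans ρ).trans e) ij.2 = ij.1 then 1 else 0,
      ⟨(e.symm.trans ρ).trans e, rfl⟩, ?_⟩
    funext ij
    simp only [LinearMap.funLeft_apply, Equiv.trans_apply, Equiv.symm_apply_apply,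
      Equiv.apply_eq_iff_eq]

end StubShadowTransport

/-- **Registered stub `stub_shadowTransport`** (transport of a plane shadow along a node
relabelling): for any enumeration `e : α ≃ Fin n` and any linear `L : ℝ^{α × α} → ℝ²` there is a
linear `L' : ℝ^{Fin n × Fin n} → ℝ²` (namely `L` precomposed with the relabelling
`(a, b) ↦ (e a, e b)`) whose image of the tree's permutation matrices `permMatrixPoints n` is
literally the `L`-image of the permutation matrices over `α`. -/
theorem stub_shadowTransport (α : Type) [Fintype α] [DecidableEq α] (n : ℕ) (e : α ≃ Fin n)
    (L : (α × α → ℝ) →ₗ[ℝ] (Fin 2 → ℝ)) :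
    ∃ L' : (Fin n × Fin n → ℝ) →ₗ[ℝ] (Fin 2 → ℝ),
      L' '' permMatrixPoints n = L '' {x | ∃ ρ : Equiv.Perm α, x = fun ij => if ρ ij.2 = ij.1 then 1 else 0} := by
  refine ⟨L.comp (LinearMap.funLeft ℝ ℝ (fun ab : α × α => (e ab.1, e ab.2))), ?_⟩
  rw [LinearMap.coe_comp, Set.image_comp, StubShadowTransport.image_funLeft_permMatrixPoints]

end Summit.ValiantsHypothesis.ValiantsHypothesis.Theorems.LacunarySymmetroidMatrixDescartes
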